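import Summits.AtomisticToContinuum.FouriersLaw.Theorems.UnboundedHeatVariance.Negative.AbstractCage
import Summits.AtomisticToContinuum.FouriersLaw.Theorems.CageBudgetFeketeUnboundedHeatVarianceAbelForm
import HarnessLib

/-!
# Stub `stub_escapeInsufficient` of line `Sketch` — the TIGHTNESS witness
(crux `CageBudgetFekete.UnboundedHeatVariance`, item stmt-AtomisticToContinuum-15771; `--supports` file)

WHAT. The registered satellite X of the skeleton `Cruxes/UnboundedHeatVariance/Lines/Sketch.lean`: the SIGN input P
(`stub_relativeNegativeSpread`) of the Abel sandwich cannot be replaced by escape-type inputs. Taking as HYPOTHESIS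
the statement of the neighbour stub F (`stub_flatFejerProfile`: an explicit flat-topped Fejér profile family
`P n m` on `ℤ` with `Σ P = 1`, `Σ x² P = m`, `|P| ≤ 4/n`, `0 ≤ P̂ ≤ 1`, `P̂(2π/n) = 0`), we build ABSTRACT profile
data `(S0, Sb, c₀)` satisfying every profile-level clause of the sandwich — weighted summability, conservation
`Σ S̄_ν = Σ S0`, Bochner positivity `χ ≥ 0`, `f̂_ν ≥ 0`, fibre dissipativity `f̂_ν ≤ χ`, the Helfand–Abel identity
with kernel `C = c₀ cos` — together with infrared non-freezing (IR) and total escape at the Hölder-½ rate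
`|S̄_ν(x)| ≤ √ν`, while the heat variance of `C` is caged (`≤ 4c₀`) and the normalised Abel function
`ν⁻¹∫e^{-νt}C` stays bounded (no divergence).

HOW. `S0 = δ₀` (so `χ ≡ 1`), `c₀ = 1/4`, `Sb ν = P (⌈4/√ν⌉₊ + 2) ((1/2)/(1+ν²))`. All profile clauses are the
conjuncts of F at these parameters; IR uses the vanishing Fourier coefficient `P̂(2π/n) = 0` (deficit `1` at a
wavenumber `k = 2π/n` with `k² ≤ 4ν`), escape is `4/n ≤ √ν`; the kernel side is the landed `δ₁`-cage
(`Negative.integral_Ioc_sub_mul_cos`) and the landed Abel function of a represented kernel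
(`Birth.inv_mul_abel_eq_integral_inv_sq_add` with `ρ = δ₁`: `ν⁻¹∫e^{-νt}cos t dt = (ν²+1)⁻¹ ≤ 1`).

No definitions; short real-analysis helper lemmas first, then the stub.
prover-line-stmt-AtomisticToContinuum-15771-c2-0, 2026-08-17.
-/

noncomputable section

namespace Summit.AtomisticToContinuum.FouriersLaw.Theorems.UnboundedHeatVariance.Sketch

open MeasureTheory Set Filter Topology

/-! ### 1. The caged kernel `C = c₀ cos` -/

/-- Laplace transform of the cosine: `∫_{t>0} e^{-νt} cos t dt = ν (ν²+1)⁻¹` for `ν > 0` (the landed Abel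
function of the kernel represented by `ρ = δ₁`). [folklore] -/
theorem integral_exp_neg_mul_cos {ν : ℝ} (hν : 0 < ν) :
    ∫ t in Ioi (0:ℝ), Real.exp (-(ν * t)) * Real.cos t = ν * (ν ^ 2 + 1)⁻¹ := by
  have hrep : ∀ t : ℝ, 0 ≤ t → Real.cos t = ∫ w, Real.cos (w * t) ∂(Measure.dirac (1:ℝ)) := by
    intro t _
    rw [integral_dirac, one_mul]
  have h := Birth.inv_mul_abel_eq_integral_inv_sq_add Real.cos (Measure.dirac (1:ℝ)) hrep hν
  rw [integral_dirac, one_pow] at h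
  rw [← h, ← mul_assoc, mul_inv_cancel₀ hν.ne', one_mul]

/-- `∫_{t>0} e^{-νt} (c₀ cos t) dt = c₀ ν (ν²+1)⁻¹` for `ν > 0`. [folklore] -/
theorem integral_exp_neg_mul_const_mul_cos (c₀ : ℝ) {ν : ℝ} (hν : 0 < ν) :
    ∫ t in Ioi (0:ℝ), Real.exp (-(ν * t)) * (c₀ * Real.cos t) = c₀ * (ν * (ν ^ 2 + 1)⁻¹) := by
  have hfun : (fun t : ℝ => Real.exp (-(ν * t)) * (c₀ * Real.cos t))
      = fun t : ℝ => c₀ * (Real.exp (-(ν * t)) * Real.cos t) := funext fun t => by ring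
  rw [hfun, integral_const_mul, integral_exp_neg_mul_cos hν]

/-- The normalised Abel function of `C = c₀ cos`: `ν⁻¹∫_{t>0} e^{-νt} c₀ cos t dt = c₀ (ν²+1)⁻¹` for `ν > 0`.
[folklore] -/
theorem inv_mul_integral_exp_neg_mul_const_mul_cos (c₀ : ℝ) {ν : ℝ} (hν : 0 < ν) :
    ν⁻¹ * ∫ t in Ioi (0:ℝ), Real.exp (-(ν * t)) * (c₀ * Real.cos t) = c₀ * (ν ^ 2 + 1)⁻¹ := by
  rw [integral_exp_neg_mul_const_mul_cos c₀ hν]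
  field_simp

/-- The normalised Abel function of `C = c₀ cos` (`c₀ ≥ 0`) is bounded by `c₀` on `ν > 0`, hence does NOT tend
to `+∞` as `ν ↓ 0`. [folklore] -/
theorem not_tendsto_abel_const_mul_cos {c₀ : ℝ} (hc : 0 ≤ c₀) :
    ¬ Tendsto (fun ν : ℝ => ν⁻¹ * ∫ t in Ioi (0:ℝ), Real.exp (-(ν * t)) * (c₀ * Real.cos t))
      (𝓝[>] (0:ℝ)) atTop := by
  intro h
  have hev := (tendsto_atTop.1 h) (c₀ + 1)
  have hpos : ∀ᶠ ν in 𝓝[>] (0:ℝ), 0 < ν := eventually_mem_nhdsWithin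
  obtain ⟨ν, hν1, hν2⟩ := (hev.and hpos).exists
  rw [inv_mul_integral_exp_neg_mul_const_mul_cos c₀ hν2] at hν1
  have h1 : (ν ^ 2 + 1)⁻¹ ≤ 1 := inv_le_one_of_one_le₀ (by nlinarith [sq_nonneg ν])
  have h2 : c₀ * (ν ^ 2 + 1)⁻¹ ≤ c₀ := mul_le_of_le_one_right hc h1
  linarith

/-- The heat variance of `C = c₀ cos` (`c₀ ≥ 0`) is caged: `2∫_{(0,τ]} (τ-s) c₀ cos s ds = 2c₀(1 - cos τ) ≤ 4c₀`
for `τ ≥ 0` (landed closed form `Negative.integral_Ioc_sub_mul_cos`), and `= 0` for `τ < 0`. [folklore] -/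
theorem heatVariance_const_mul_cos_le {c₀ : ℝ} (hc : 0 ≤ c₀) (τ : ℝ) :
    2 * ∫ s in Ioc (0:ℝ) τ, (τ - s) * (c₀ * Real.cos s) ≤ 4 * c₀ := by
  rcases lt_or_ge τ 0 with hτ | hτ
  · rw [Ioc_eq_empty (not_lt.2 hτ.le), Measure.restrict_empty, integral_zero_measure, mul_zero]
    positivity
  have hfun : (fun s : ℝ => (τ - s) * (c₀ * Real.cos s))
      = fun s : ℝ => c₀ * ((τ - s) * Real.cos (1 * s)) := funext fun s => by rw [one_mul]; ring
  rw [hfun, integral_const_mul, Negative.integral_Ioc_sub_mul_cos one_ne_zero hτ, one_mul, one_pow, div_one]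
  have h1 : 0 ≤ c₀ * (1 + Real.cos τ) := mul_nonneg hc (by linarith [Real.neg_one_le_cos τ])
  nlinarith

/-! ### 2. The frozen reference profile `S0 = δ₀` -/

/-- `δ₀` has finite weighted mass `Σ(1+x²)|δ₀(x)|`. [folklore] -/
theorem weighted_summable_ite_eq_zero :
    Summable (fun x : ℤ => (1 + (x : ℝ) ^ 2) * |(if x = 0 then (1:ℝ) else 0)|) :=
  summable_of_ne_finset_zero (s := {0}) fun x hx => by
    rw [Finset.mem_singleton] at hx
    rw [if_neg hx, abs_zero, mul_zero]

/-- `Σ_x δ₀(x) = 1`. [folklore] -/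
theorem tsum_ite_eq_zero : ∑' x : ℤ, (if x = 0 then (1:ℝ) else 0) = 1 := by
  rw [tsum_eq_single 0 fun x hx => if_neg hx, if_pos rfl]

/-- `χ(k) = Σ_x cos(kx) δ₀(x) = 1` for every wavenumber `k`. [folklore] -/
theorem tsum_cos_mul_ite_eq_zero (k : ℝ) :
    ∑' x : ℤ, Real.cos (k * (x : ℝ)) * (if x = 0 then (1:ℝ) else 0) = 1 := by
  rw [tsum_eq_single 0 fun x hx => by rw [if_neg hx, mul_zero]]
  simp

/-- `Σ_x x² δ₀(x) = 0`. [folklore] -/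
theorem tsum_sq_mul_ite_eq_zero : ∑' x : ℤ, (x : ℝ) ^ 2 * (if x = 0 then (1:ℝ) else 0) = 0 := by
  rw [tsum_eq_single 0 fun x hx => by rw [if_neg hx, mul_zero]]
  simp

/-! ### 3. The parameters `n ν = ⌈4/√ν⌉₊ + 2`, `m ν = (1/2)/(1+ν²)` -/

/-- `4/√ν ≤ ⌈4/√ν⌉₊ + 2`. [folklore] -/
theorem four_div_sqrt_le_natCeil (ν : ℝ) : 4 / Real.sqrt ν ≤ ((⌈4 / Real.sqrt ν⌉₊ + 2 : ℕ) : ℝ) := by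
  push_cast
  linarith [Nat.le_ceil (4 / Real.sqrt ν)]

/-- Total escape at the Hölder-½ rate: `4/(⌈4/√ν⌉₊ + 2) ≤ √ν` for `ν > 0`. [folklore] -/
theorem four_div_natCeil_le_sqrt {ν : ℝ} (hν : 0 < ν) :
    4 / ((⌈4 / Real.sqrt ν⌉₊ + 2 : ℕ) : ℝ) ≤ Real.sqrt ν := by
  have hs : 0 < Real.sqrt ν := Real.sqrt_pos.2 hν
  have hn : (0:ℝ) < ((⌈4 / Real.sqrt ν⌉₊ + 2 : ℕ) : ℝ) := by positivity
  have h4 := four_div_sqrt_le_natCeil ν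
  rw [div_le_iff₀ hs] at h4
  rw [div_le_iff₀ hn]
  linarith [mul_comm (Real.sqrt ν) ((⌈4 / Real.sqrt ν⌉₊ + 2 : ℕ) : ℝ)]

/-- The infrared wavenumber `k = 2π/n` is small: if `4/√ν ≤ n` (`ν > 0`) then `(2π/n)² ≤ 4ν` (using `π ≤ 4`).
[folklore] -/
theorem sq_two_pi_div_le {ν n : ℝ} (hν : 0 < ν) (hn : 4 / Real.sqrt ν ≤ n) :
    (2 * Real.pi / n) ^ 2 ≤ 4 * ν := by
  have hs : 0 < Real.sqrt ν := Real.sqrt_pos.2 hν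
  have h4 : 0 < 4 / Real.sqrt ν := by positivity
  have hnpos : 0 < n := h4.trans_le hn
  have hk0 : 0 ≤ 2 * Real.pi / n := by positivity
  have hk1 : 2 * Real.pi / n ≤ 2 * Real.pi / (4 / Real.sqrt ν) :=
    div_le_div_of_nonneg_left (by positivity) h4 hn
  have hk2 : 2 * Real.pi / (4 / Real.sqrt ν) = Real.pi / 2 * Real.sqrt ν := by
    field_simp
    norm_num
  have hk3 : 2 * Real.pi / n ≤ 2 * Real.sqrt ν := by
    rw [hk2] at hk1
    nlinarith [Real.pi_le_four, hs.le]
  calc (2 * Real.pi / n) ^ 2 ≤ (2 * Real.sqrt ν) ^ 2 := pow_le_pow_left₀ hk0 hk3 2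
    _ = 4 * ν := by rw [mul_pow, Real.sq_sqrt hν.le]; norm_num

/-- `cos(2π/n) ≠ 1` for `2 ≤ n`. [folklore] -/
theorem cos_two_pi_div_ne_one {n : ℝ} (hn : 2 ≤ n) : Real.cos (2 * Real.pi / n) ≠ 1 := by
  have hnpos : 0 < n := by linarith
  have hk0 : 0 < 2 * Real.pi / n := div_pos Real.two_pi_pos hnpos
  have hk1 : 2 * Real.pi / n < 2 * Real.pi := div_lt_self Real.two_pi_pos (by linarith)
  rw [Ne, Real.cos_eq_one_iff_of_lt_of_lt (by linarith) hk1]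
  exact hk0.ne'

/-- The infrared deficit inequality: `M (2 - 2cos k) ≤ 1` whenever `k² ≤ 4ν` and `4(|M|+1)ν ≤ 1`
(`2 - 2cos k ≤ k²`, `Real.one_sub_sq_div_two_le_cos`). [folklore] -/
theorem mul_two_sub_two_cos_le_one {M ν k : ℝ} (hk : k ^ 2 ≤ 4 * ν) (hνM : 4 * (|M| + 1) * ν ≤ 1) :
    M * (2 - 2 * Real.cos k) ≤ 1 := by
  have hcos : 2 - 2 * Real.cos k ≤ k ^ 2 := by
    have := Real.one_sub_sq_div_two_le_cos (x := k)
    linarith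
  have h22 : 0 ≤ 2 - 2 * Real.cos k := by linarith [Real.cos_le_one k]
  rcases le_or_gt M 0 with hM | hM
  · have := mul_nonneg (neg_nonneg.2 hM) h22
    linarith
  · have h1 : M * (2 - 2 * Real.cos k) ≤ M * (4 * ν) := mul_le_mul_of_nonneg_left (hcos.trans hk) hM.le
    have h2 : M * (4 * ν) ≤ 1 := by
      rw [abs_of_pos hM] at hνM
      nlinarith
    linarith

/-! ### 4. The witness from an abstract flat-topped profile family -/

/-- **Escape is insufficient (abstract form).** From ANY profile family `P n m` on `ℤ` (`2 ≤ n`, `0 ≤ m ≤ 1/2`)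
with `Σ(1+x²)|P| < ∞`, `Σ P = 1`, `Σ x² P = m`, `|P| ≤ 4/n`, `0 ≤ P̂ ≤ 1` and `P̂(2π/n) = 0`, the data
`S0 = δ₀`, `Sb ν = P (⌈4/√ν⌉₊ + 2) ((1/2)/(1+ν²))`, `c₀ = 1/4` satisfy all profile-level clauses of the Abel
sandwich, IR, and total escape `|Sb ν x| ≤ √ν`, while `C = c₀ cos` is caged and its Abel function is bounded.
[folklore] -/
theorem escapeInsufficient_of_profile (P : ℕ → ℝ → ℤ → ℝ)
    (hP : ∀ n : ℕ, 2 ≤ n → ∀ m : ℝ, 0 ≤ m → m ≤ 1 / 2 →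
      (∀ x : ℤ, 2 * (n : ℤ) < |x| → P n m x = 0) ∧
      Summable (fun x : ℤ => (1 + (x : ℝ) ^ 2) * |P n m x|) ∧
      ∑' x : ℤ, P n m x = 1 ∧
      ∑' x : ℤ, (x : ℝ) ^ 2 * P n m x = m ∧
      (∀ x : ℤ, |P n m x| ≤ 4 / (n : ℝ)) ∧
      (∀ k : ℝ, 0 ≤ ∑' x : ℤ, Real.cos (k * (x : ℝ)) * P n m x ∧
        ∑' x : ℤ, Real.cos (k * (x : ℝ)) * P n m x ≤ 1) ∧
      ∑' x : ℤ, Real.cos (2 * Real.pi / (n : ℝ) * (x : ℝ)) * P n m x = 0) :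
    ∃ (S0 : ℤ → ℝ) (Sb : ℝ → ℤ → ℝ) (c₀ : ℝ), 0 < c₀ ∧
      Summable (fun x : ℤ => (1 + (x : ℝ) ^ 2) * |S0 x|) ∧
      (∀ ν : ℝ, 0 < ν → Summable (fun x : ℤ => (1 + (x : ℝ) ^ 2) * |Sb ν x|)) ∧
      0 < ∑' x : ℤ, S0 x ∧
      (∀ ν : ℝ, 0 < ν → ∑' x : ℤ, Sb ν x = ∑' x : ℤ, S0 x) ∧
      (∀ k : ℝ, 0 ≤ ∑' x : ℤ, Real.cos (k * (x : ℝ)) * S0 x) ∧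
      (∀ ν : ℝ, 0 < ν → ∀ k : ℝ, 0 ≤ ∑' x : ℤ, Real.cos (k * (x : ℝ)) * Sb ν x) ∧
      (∀ ν : ℝ, 0 < ν → ∀ k : ℝ, ∑' x : ℤ, Real.cos (k * (x : ℝ)) * Sb ν x ≤
        ∑' x : ℤ, Real.cos (k * (x : ℝ)) * S0 x) ∧
      (∀ ν : ℝ, 0 < ν → ∫ t in Set.Ioi (0:ℝ), Real.exp (-(ν * t)) * (c₀ * Real.cos t) =
        ν / 2 * ((∑' x : ℤ, (x : ℝ) ^ 2 * Sb ν x) - ∑' x : ℤ, (x : ℝ) ^ 2 * S0 x)) ∧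
      (∀ M ν₁ : ℝ, 0 < ν₁ → ∃ k : ℝ, Real.cos k ≠ 1 ∧ ∃ ν : ℝ, 0 < ν ∧ ν < ν₁ ∧
        M * (2 - 2 * Real.cos k) ≤ (∑' x : ℤ, Real.cos (k * (x : ℝ)) * S0 x) -
          ∑' x : ℤ, Real.cos (k * (x : ℝ)) * Sb ν x) ∧
      (∀ ν : ℝ, 0 < ν → ∀ x : ℤ, |Sb ν x| ≤ Real.sqrt ν) ∧
      (∀ τ : ℝ, 2 * ∫ s in Set.Ioc (0:ℝ) τ, (τ - s) * (c₀ * Real.cos s) ≤ 4 * c₀) ∧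
      ¬ Filter.Tendsto (fun ν : ℝ => ν⁻¹ * ∫ t in Set.Ioi (0:ℝ), Real.exp (-(ν * t)) *
        (c₀ * Real.cos t)) (nhdsWithin (0:ℝ) (Set.Ioi 0)) Filter.atTop := by
  -- admissibility of the parameters `n ν = ⌈4/√ν⌉₊ + 2 ≥ 2`, `0 ≤ m ν = (1/2)/(1+ν²) ≤ 1/2`
  have hN2 : ∀ ν : ℝ, 2 ≤ ⌈4 / Real.sqrt ν⌉₊ + 2 := fun ν => Nat.le_add_left 2 _
  have hμ0 : ∀ ν : ℝ, (0:ℝ) ≤ 1 / 2 / (1 + ν ^ 2) := fun ν => by positivity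
  have hμ1 : ∀ ν : ℝ, 1 / 2 / (1 + ν ^ 2) ≤ (1:ℝ) / 2 := fun ν =>
    div_le_self (by norm_num) (by nlinarith [sq_nonneg ν])
  have hQ := fun ν : ℝ => hP _ (hN2 ν) _ (hμ0 ν) (hμ1 ν)
  refine ⟨fun x => if x = 0 then 1 else 0,
    fun ν x => P (⌈4 / Real.sqrt ν⌉₊ + 2) (1 / 2 / (1 + ν ^ 2)) x, 1 / 4, by norm_num,
    weighted_summable_ite_eq_zero, fun ν _ => (hQ ν).2.1, ?_, fun ν _ => ?_, fun k => ?_,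
    fun ν _ k => ((hQ ν).2.2.2.2.2.1 k).1, fun ν _ k => ?_, fun ν hν => ?_, fun M ν₁ hν₁ => ?_,
    fun ν hν x => ((hQ ν).2.2.2.2.1 x).trans (four_div_natCeil_le_sqrt hν),
    heatVariance_const_mul_cos_le (by norm_num), not_tendsto_abel_const_mul_cos (by norm_num)⟩
  · -- `0 < Σ S0 = 1`
    rw [tsum_ite_eq_zero]
    exact one_pos
  · -- conservation `Σ Sb ν = 1 = Σ S0`
    rw [tsum_ite_eq_zero]
    exact (hQ ν).2.2.1
  · -- Bochner positivity of `χ ≡ 1`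
    rw [tsum_cos_mul_ite_eq_zero]
    exact zero_le_one
  · -- fibre dissipativity `f̂ ≤ 1 = χ`
    rw [tsum_cos_mul_ite_eq_zero]
    exact ((hQ ν).2.2.2.2.2.1 k).2
  · -- Helfand–Abel identity: both sides equal `ν / (4(1+ν²))`
    rw [integral_exp_neg_mul_const_mul_cos _ hν, (hQ ν).2.2.2.1, tsum_sq_mul_ite_eq_zero]
    have h1 : (ν ^ 2 + 1) ≠ 0 := by positivity
    field_simp
    ring
  · -- infrared non-freezing: deficit `1` at `k = 2π/n`, `n = ⌈4/√ν⌉₊ + 2`, `ν` small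
    have hM1 : 0 < |M| + 1 := by positivity
    obtain ⟨ν, hν0, hνlt, hνM⟩ : ∃ ν : ℝ, 0 < ν ∧ ν < ν₁ ∧ 4 * (|M| + 1) * ν ≤ 1 := by
      refine ⟨min (ν₁ / 2) (1 / (4 * (|M| + 1))), lt_min (by linarith) (by positivity),
        (min_le_left _ _).trans_lt (by linarith), ?_⟩
      calc 4 * (|M| + 1) * min (ν₁ / 2) (1 / (4 * (|M| + 1)))
          ≤ 4 * (|M| + 1) * (1 / (4 * (|M| + 1))) :=
            mul_le_mul_of_nonneg_left (min_le_right _ _) (by positivity)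
        _ = 1 := by field_simp
    have hn4 := four_div_sqrt_le_natCeil ν
    have hn2 : (2:ℝ) ≤ ((⌈4 / Real.sqrt ν⌉₊ + 2 : ℕ) : ℝ) := by exact_mod_cast hN2 ν
    refine ⟨2 * Real.pi / ((⌈4 / Real.sqrt ν⌉₊ + 2 : ℕ) : ℝ), cos_two_pi_div_ne_one hn2, ν, hν0, hνlt, ?_⟩
    rw [tsum_cos_mul_ite_eq_zero, (hQ ν).2.2.2.2.2.2, sub_zero]
    exact mul_two_sub_two_cos_le_one (sq_two_pi_div_le hν0 hn4) hνM

/-- **X — `stub_escapeInsufficient` (registered TIGHTNESS satellite of line `Sketch`).** Assuming the statement of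
the neighbour stub F (`stub_flatFejerProfile`: the explicit flat-topped Fejér profile `P n m` on `ℤ`), there are
abstract profile data `(S0, Sb, c₀)` satisfying every profile-level clause of the Abel sandwich (weighted
summability, conservation, `χ ≥ 0`, `f̂_ν ≥ 0`, `f̂_ν ≤ χ`, Helfand–Abel with `C = c₀ cos`), infrared non-freezing
and total escape `|S̄_ν(x)| ≤ √ν`, while the heat variance of `C` is caged (`≤ 4c₀`) and `ν⁻¹∫e^{-νt}C` does not
tend to `+∞`: the sign input P is indispensable to the sandwich method. Witness: `S0 = δ₀`, `c₀ = 1/4`,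
`Sb ν = P (⌈4/√ν⌉₊ + 2) ((1/2)/(1+ν²))` (`escapeInsufficient_of_profile`). [folklore] -/
theorem stub_escapeInsufficient :
    (∀ a : ℕ → ℤ → ℝ, a = (fun (n : ℕ) (x : ℤ) => ((n : ℝ) ^ 2)⁻¹ * ∑ i ∈ Finset.range n, ∑ j ∈ Finset.range n, if (i : ℤ) - (j : ℤ) = x then (1 : ℝ) else 0) → ∀ c : ℕ → ℤ → ℝ, c = (fun (n : ℕ) (x : ℤ) => ((n : ℝ) ^ 4)⁻¹ * ∑ i ∈ Finset.range n, ∑ j ∈ Finset.range n, ∑ i' ∈ Finset.range n, ∑ j' ∈ Finset.range n, if (i : ℤ) - (j : ℤ) + ((i' : ℤ) - (j' : ℤ)) = x then (1 : ℝ) else 0) → ∀ P : ℕ → ℝ → ℤ → ℝ, P = (fun (n : ℕ) (m : ℝ) (x : ℤ) => 2 * a n x - c n x - m * (a n x - (a n (x - 1) + a n (x + 1)) / 2)) → ∀ n : ℕ, 2 ≤ n → ∀ m : ℝ, 0 ≤ m → m ≤ 1 / 2 → (∀ x : ℤ, 2 * (n : ℤ) < |x| → P n m x = 0) ∧ Summable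 (fun x : ℤ => (1 + (x : ℝ) ^ 2) * |P n m x|) ∧ ∑' x : ℤ, P n m x = 1 ∧ ∑' x : ℤ, (x : ℝ) ^ 2 * P n m x = m ∧ (∀ x : ℤ, |P n m x| ≤ 4 / (n : ℝ)) ∧ (∀ k : ℝ, 0 ≤ ∑' x : ℤ, Real.cos (k * (x : ℝ)) * P n m x ∧ ∑' x : ℤ, Real.cos (k * (x : ℝ)) * P n m x ≤ 1) ∧ ∑' x : ℤ, Real.cos (2 * Real.pi / (n : ℝ) * (x : ℝ)) * P n m x = 0) → ∃ (S0 : ℤ → ℝ) (Sb : ℝ → ℤ → ℝ) (c₀ : ℝ), 0 < c₀ ∧ Summable (fun x : ℤ => (1 + (x : ℝ) ^ 2) * |S0 x|) ∧ (∀ ν : ℝ, 0 < ν → Summable (fun x : ℤ => (1 + (x : ℝ) ^ 2) * |Sb ν x|)) ∧ 0 < ∑' x : ℤ, S0 x ∧ (∀ ν : ℝ, 0 < ν → ∑' x : ℤ, Sb ν x = ∑' x : ℤ, S0 x) ∧ (∀ k : ℝ, 0 ≤ ∑' x : ℤ, Real.cos (k * (x : ℝ)) * S0 x) ∧ (∀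 ν : ℝ, 0 < ν → ∀ k : ℝ, 0 ≤ ∑' x : ℤ, Real.cos (k * (x : ℝ)) * Sb ν x) ∧ (∀ ν : ℝ, 0 < ν → ∀ k : ℝ, ∑' x : ℤ, Real.cos (k * (x : ℝ)) * Sb ν x ≤ ∑' x : ℤ, Real.cos (k * (x : ℝ)) * S0 x) ∧ (∀ ν : ℝ, 0 < ν → ∫ t in Set.Ioi (0:ℝ), Real.exp (-(ν * t)) * (c₀ * Real.cos t) = ν / 2 * ((∑' x : ℤ, (x : ℝ) ^ 2 * Sb ν x) - ∑' x : ℤ, (x : ℝ) ^ 2 * S0 x)) ∧ (∀ M ν₁ : ℝ, 0 < ν₁ → ∃ k : ℝ, Real.cos k ≠ 1 ∧ ∃ ν : ℝ, 0 < ν ∧ ν < ν₁ ∧ M * (2 - 2 * Real.cos k) ≤ (∑' x : ℤ, Real.cos (k * (x : ℝ)) * S0 x) - ∑' x : ℤ, Real.cos (k * (x : ℝ)) * Sb ν x) ∧ (∀ ν : ℝ, 0 < ν → ∀ x : ℤ, |Sb ν x| ≤ Real.sqrt ν) ∧ (∀ τ : ℝ, 2 * ∫ s in Set.Ioc (0:ℝ)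 τ, (τ - s) * (c₀ * Real.cos s) ≤ 4 * c₀) ∧ ¬ Filter.Tendsto (fun ν : ℝ => ν⁻¹ * ∫ t in Set.Ioi (0:ℝ), Real.exp (-(ν * t)) * (c₀ * Real.cos t)) (nhdsWithin (0:ℝ) (Set.Ioi 0)) Filter.atTop := by
  intro hF
  exact escapeInsufficient_of_profile _ (hF _ rfl _ rfl _ rfl)

end Summit.AtomisticToContinuum.FouriersLaw.Theorems.UnboundedHeatVariance.Sketch
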